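import Literature.AlgebraicGeometry.Motives.QuadricHypersurfaceLines
import HarnessLib

/-!
# `CH₁` of a smooth complete intersection of a quadric with hyperplanes is generated by lines
# (Tian–Zong Thm. 1.7 for the multidegrees `(2, 1, …, 1)`)

The named fact `TianZong2014_chowOne_generatedByLines` (Compositio Math. 150 (2014), Thm. 1.7) for
complete intersections `X ⊆ ℙⁿ⁺ᶜ` of multidegree `d` with exactly one `dₐ = 2` and all other
`dₐ = 1`: `X` is a quadric in the linear subspace `Λ = V₊(linear forms) ≅ ℙ^{n+c-t}`, and the
cellular argument of `Motives/QuadricHypersurfaceLines` applies inside `Λ` after (i) moving the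
linear forms to the first coordinates (`exists_linearSubst_first`), (ii) killing those coordinates
in the quadric, and (iii) bringing the remaining quadratic form — of any rank `r`, no Jacobian
hypothesis is needed — to the block split form `x_t x_{t+1} + ⋯` by a substitution of the last
variables only (`Motives/SplitQuadricNormalForm.exists_matrix_eval_eq_eval_splitFormAt_rank`
in the smaller polynomial ring, re-embedded by `rename`): then `X ↪ T(t, r)` is a stratum of
`Motives/QuadricStrataIdeals` and `linesRep_of_range_eq_stratum` applies (`r ≥ 3`; `r ≤ 1` is
linear, and `r = 2` cannot occur for an integral `X`).

* `TianZong2014_chowOne_generatedByLines_quadricSection` — the fact's statement with the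
  hypothesis `∃ a₀, d a₀ = 2 ∧ ∀ a ≠ a₀, d a = 1`.

Everything is proved; no named facts.

## References

* [TianZong2014] Z. Tian, H. R. Zong, *One-cycles on rationally connected varieties*, Thm. 1.7.
* W. Fulton, *Intersection Theory*, Example 1.9.1. [Fulton1998]
* R. Hartshorne, *Algebraic Geometry*, II Example 7.1.1. [Hartshorne1977]
-/

noncomputable section

open CategoryTheory AlgebraicGeometry Order TopologicalSpace

universe u

namespace Literature.AlgebraicGeometry.Motives

namespace ProjectiveSpaceCells

open _root_.MvPolynomial

/-! ### Re-embedding the split form and substitutions from the last `N - t + 1` variables -/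

section Block

variable (k : Type u) [Field k] {N : ℕ} (t N' : ℕ) (hN : t + N' = N)

/-- The embedding of the last block of variables: `i ↦ t + i`. [folklore] -/
def embIdx (i : Fin (N' + 1)) : Fin (N + 1) := ⟨t + (i : ℕ), by omega⟩

/-- Auxiliary computation (`embIdx_injective`). [folklore] -/
theorem embIdx_injective : Function.Injective (embIdx t N' hN) := fun a b hab ↦
  Fin.ext (by have := congrArg Fin.val hab; simp [embIdx] at this; omega)

/-- `rename` along the block embedding sends the split form of the small ring to the block form.
[folklore] -/
theorem rename_embIdx_splitFormAt : ∀ (m s : ℕ) (hsm : s + m ≤ N' + 1),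
    MvPolynomial.rename (embIdx t N' hN) (splitFormAt k s m hsm) = splitFormAt k (t + s) m (by omega) := by
  intro m
  induction m using Nat.strong_induction_on with
  | _ m ih =>
    intro s hsm
    rcases m with _ | _ | m
    · rw [splitFormAt_zero, splitFormAt_zero, map_zero]
    · rw [splitFormAt_one, splitFormAt_one, map_mul, MvPolynomial.rename_X]
      rfl
    · rw [splitFormAt_add_two, splitFormAt_add_two, map_add, map_mul, MvPolynomial.rename_X,
        MvPolynomial.rename_X, ih m (by omega) (s + 2) (by omega)]
      have h1 : (embIdx t N' hN ⟨s, by omega⟩ : Fin (N + 1)) = ⟨t + s, by omega⟩ := rfl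
      have h2 : (embIdx t N' hN ⟨s + 1, by omega⟩ : Fin (N + 1)) = ⟨t + s + 1, by omega⟩ :=
        Fin.ext (by simp [embIdx]; omega)
      rw [h1, h2]
      congr 1

/-- Extracting the small-ring polynomial: `xⱼ ↦ y_{j-t}` (`j ≥ t`), `xⱼ ↦ 0` (`j < t`). [folklore] -/
def extractBlock : MvPolynomial (Fin (N + 1)) k →ₐ[k] MvPolynomial (Fin (N' + 1)) k :=
  MvPolynomial.aeval fun j ↦ if h : t ≤ (j : ℕ) then MvPolynomial.X ⟨(j : ℕ) - t, by omega⟩ else 0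

/-- `rename emb ∘ extractBlock = killSet {j < t}`. [folklore] -/
theorem rename_embIdx_comp_extractBlock [DecidablePred (· ∈ {j : Fin (N + 1) | (j : ℕ) < t})] :
    (MvPolynomial.rename (embIdx t N' hN)).comp (extractBlock k t N' hN) =
      killSet k {j : Fin (N + 1) | (j : ℕ) < t} := by
  refine MvPolynomial.algHom_ext fun j ↦ ?_
  simp only [AlgHom.coe_comp, Function.comp_apply, extractBlock, MvPolynomial.aeval_X]
  by_cases hj : t ≤ (j : ℕ)
  · rw [dif_pos hj, MvPolynomial.rename_X, killSet_X_of_notMem (by simp; omega)]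
    congr 1
    exact Fin.ext (by simp [embIdx]; omega)
  · rw [dif_neg hj, map_zero, killSet_X_of_mem (by simp; omega)]

/-- A polynomial fixed by killing `x_{<t}` is re-embedded from its extraction. [folklore] -/
theorem rename_embIdx_extractBlock [DecidablePred (· ∈ {j : Fin (N + 1) | (j : ℕ) < t})]
    {Q : MvPolynomial (Fin (N + 1)) k} (hQ : killSet k {j : Fin (N + 1) | (j : ℕ) < t} Q = Q) :
    MvPolynomial.rename (embIdx t N' hN) (extractBlock k t N' hN Q) = Q := by
  have h := congr($(rename_embIdx_comp_extractBlock k t N' hN) Q)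
  simp only [AlgHom.coe_comp, Function.comp_apply] at h
  rw [h, hQ]

/-- The extraction of a quadratic form is a quadratic form. [folklore] -/
theorem isHomogeneous_extractBlock {Q : MvPolynomial (Fin (N + 1)) k} (hQ : Q.IsHomogeneous 2) :
    (extractBlock k t N' hN Q).IsHomogeneous 2 := by
  exact hQ.aeval (fun j : Fin (N + 1) ↦ if h : t ≤ (j : ℕ) then
    (MvPolynomial.X ⟨(j : ℕ) - t, by omega⟩ : MvPolynomial (Fin (N' + 1)) k) else 0) fun j ↦ by
    by_cases hj : t ≤ (j : ℕ)
    · simp only [dif_pos hj]; exact MvPolynomial.isHomogeneous_X k _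
    · simp only [dif_neg hj]; exact MvPolynomial.isHomogeneous_zero _ _ _

variable (τs τs' : Fin (N' + 1) → MvPolynomial (Fin (N' + 1)) k)

/-- **Block extension of a substitution** of the small ring: identity on `x_{<t}`, `rename emb ∘ τ`
on the block. [folklore] -/
def extendSubst : Fin (N + 1) → MvPolynomial (Fin (N + 1)) k := fun j ↦
  if h : t ≤ (j : ℕ) then MvPolynomial.rename (embIdx t N' hN) (τs ⟨(j : ℕ) - t, by omega⟩)
    else MvPolynomial.X j

/-- Auxiliary computation (`extendSubst_of_lt`). [folklore] -/
theorem extendSubst_of_lt {j : Fin (N + 1)} (hj : (j : ℕ) < t) : extendSubst k t N' hN τs j = MvPolynomial.X j := by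
  simp [extendSubst, show ¬ t ≤ (j : ℕ) by omega]

/-- Auxiliary computation (`extendSubst_embIdx`). [folklore] -/
theorem extendSubst_embIdx (i : Fin (N' + 1)) :
    extendSubst k t N' hN τs (embIdx t N' hN i) = MvPolynomial.rename (embIdx t N' hN) (τs i) := by
  simp only [extendSubst, embIdx, le_add_iff_nonneg_right, zero_le, ↓reduceDIte]
  congr 2
  exact Fin.ext (by simp)

/-- Auxiliary computation (`isHomogeneous_extendSubst`). [folklore] -/
theorem isHomogeneous_extendSubst (hτ : ∀ i, (τs i).IsHomogeneous 1) (j : Fin (N + 1)) :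
    (extendSubst k t N' hN τs j).IsHomogeneous 1 := by
  unfold extendSubst
  split_ifs
  · exact (hτ _).rename_isHomogeneous
  · exact MvPolynomial.isHomogeneous_X k j

/-- `aeval (extend τ) ∘ rename emb = rename emb ∘ aeval τ`. [folklore] -/
theorem aeval_extendSubst_comp_rename :
    (MvPolynomial.aeval (extendSubst k t N' hN τs)).comp (MvPolynomial.rename (embIdx t N' hN)) =
      (MvPolynomial.rename (embIdx t N' hN)).comp (MvPolynomial.aeval τs) := by
  refine MvPolynomial.algHom_ext fun i ↦ ?_
  simp only [AlgHom.coe_comp, Function.comp_apply, MvPolynomial.rename_X, MvPolynomial.aeval_X]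
  exact extendSubst_embIdx k t N' hN τs i

/-- The block extensions of inverse substitutions are inverse. [folklore] -/
theorem extendSubst_inv (hinv : ∀ p, MvPolynomial.aeval τs (MvPolynomial.aeval τs' p) = p)
    (p : MvPolynomial (Fin (N + 1)) k) :
    MvPolynomial.aeval (extendSubst k t N' hN τs) (MvPolynomial.aeval (extendSubst k t N' hN τs') p) = p := by
  have h : (MvPolynomial.aeval (extendSubst k t N' hN τs)).comp (MvPolynomial.aeval (extendSubst k t N' hN τs')) =
      AlgHom.id k _ := by
    refine MvPolynomial.algHom_ext fun j ↦ ?_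
    simp only [AlgHom.coe_comp, Function.comp_apply, MvPolynomial.aeval_X, AlgHom.coe_id, id_eq]
    by_cases hj : (j : ℕ) < t
    · rw [extendSubst_of_lt k t N' hN τs' hj, MvPolynomial.aeval_X, extendSubst_of_lt k t N' hN τs hj]
    · have hj' : j = embIdx t N' hN ⟨(j : ℕ) - t, by omega⟩ := Fin.ext (by simp [embIdx]; omega)
      rw [hj', extendSubst_embIdx, ← AlgHom.comp_apply, aeval_extendSubst_comp_rename, AlgHom.comp_apply,
        ← MvPolynomial.aeval_X (R := k) τs' ⟨(j : ℕ) - t, _⟩, hinv, MvPolynomial.rename_X]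
  exact congr($h p)

/-- Independence of the block-extended substitution. [folklore] -/
theorem linearIndependent_extendSubst
    (hinv' : ∀ p, MvPolynomial.aeval τs' (MvPolynomial.aeval τs p) = p) :
    LinearIndependent k (extendSubst k t N' hN τs) := by
  -- `extend τ = aeval (extend τ) ∘ X`, and `aeval (extend τ)` is injective
  have h : extendSubst k t N' hN τs = ⇑(MvPolynomial.aeval (extendSubst k t N' hN τs)).toLinearMap ∘
      fun j ↦ (MvPolynomial.X j : MvPolynomial (Fin (N + 1)) k) := by
    funext j
    simp only [Function.comp_apply, AlgHom.toLinearMap_apply, MvPolynomial.aeval_X]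
  rw [h]
  refine (MvPolynomial.linearIndependent_X (Fin (N + 1)) k).map' _ ?_
  rw [LinearMap.ker_eq_bot]
  intro p q hpq
  have h' := congrArg (MvPolynomial.aeval (extendSubst k t N' hN τs')) hpq
  change MvPolynomial.aeval (extendSubst k t N' hN τs') (MvPolynomial.aeval (extendSubst k t N' hN τs) p) =
    MvPolynomial.aeval (extendSubst k t N' hN τs') (MvPolynomial.aeval (extendSubst k t N' hN τs) q) at h'
  rwa [extendSubst_inv k t N' hN τs' τs hinv', extendSubst_inv k t N' hN τs' τs hinv'] at h'

end Block

/-! ### Linear forms to the first coordinates -/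

section First

variable {k : Type u} [Field k] {N : ℕ}

/-- **Extending independent vectors to a basis, prescribed at the first positions.** [folklore] -/
theorem exists_basis_extending_first {c m : ℕ} (w : Fin c → (Fin (N + 1) → k))
    (hw : LinearIndependent k w) (h : N + 1 = c + m) :
    ∃ b : Module.Basis (Fin (N + 1)) k (Fin (N + 1) → k), ∀ a : Fin c, b ⟨a, by omega⟩ = w a := by
  classical
  let B := Module.Basis.sumExtend hw
  haveI : Finite (Fin c ⊕ Module.Basis.sumExtendIndex hw) :=
    Module.Finite.finite_basis (R := k) (M := Fin (N + 1) → k) B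
  haveI : Finite (Module.Basis.sumExtendIndex hw) :=
    Finite.of_injective (Sum.inr : _ → Fin c ⊕ Module.Basis.sumExtendIndex hw) Sum.inr_injective
  haveI : Fintype (Module.Basis.sumExtendIndex hw) := Fintype.ofFinite _
  have hcard : Fintype.card (Module.Basis.sumExtendIndex hw) = m := by
    have h1 := Module.finrank_eq_card_basis B
    rw [Module.finrank_fin_fun, Fintype.card_sum, Fintype.card_fin] at h1
    omega
  let eJ : Module.Basis.sumExtendIndex hw ≃ Fin m := Fintype.equivFinOfCardEq hcard
  let E : (Fin c ⊕ Module.Basis.sumExtendIndex hw) ≃ Fin (N + 1) :=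
    (Equiv.sumCongr (Equiv.refl _) eJ).trans (finSumFinEquiv.trans (finCongr h.symm))
  refine ⟨B.reindex E, fun a ↦ ?_⟩
  rw [Module.Basis.reindex_apply]
  have hE : E.symm ⟨a, by omega⟩ = Sum.inl a := by
    rw [Equiv.symm_apply_eq]
    simp only [E, Equiv.trans_apply, Equiv.sumCongr_apply, Sum.map_inl, Equiv.refl_apply,
      finSumFinEquiv_apply_left, finCongr_apply]
    exact Fin.ext (by simp)
  rw [hE]
  simp only [B, Module.Basis.sumExtend, Module.Basis.reindex_apply, Equiv.symm_symm]
  erw [Module.Basis.extend_apply_self]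
  dsimp only [Trans.trans]
  erw [Equiv.trans_apply, Equiv.sumCongr_apply, Sum.map_inl, Equiv.Set.sumDiffSubset_apply_inl,
    Set.coe_inclusion, Equiv.ofInjective_apply]

/-- **An invertible linear substitution sending the first `t` variables to given independent linear
forms.** [folklore] -/
theorem exists_linearSubst_first {t : ℕ} (ht : t ≤ N + 1) (L : Fin t → MvPolynomial (Fin (N + 1)) k)
    (hL : ∀ a, (L a).IsHomogeneous 1) (hli : LinearIndependent k L) :
    ∃ τ τ' : Fin (N + 1) → MvPolynomial (Fin (N + 1)) k,
      (∀ j, (τ j).IsHomogeneous 1) ∧ (∀ j, (τ' j).IsHomogeneous 1) ∧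
        (∀ p, MvPolynomial.aeval τ (MvPolynomial.aeval τ' p) = p) ∧
          (∀ p, MvPolynomial.aeval τ' (MvPolynomial.aeval τ p) = p) ∧
          (∀ a : Fin t, τ ⟨a, by omega⟩ = L a) ∧ LinearIndependent k τ := by
  classical
  let w : Fin t → (Fin (N + 1) → k) := fun a j ↦ MvPolynomial.coeff (Finsupp.single j 1) (L a)
  have hwL : ∀ a, lin (w a) = L a := fun a ↦ (eq_lin_of_isHomogeneous_one (hL a)).symm
  have hw : LinearIndependent k w := by
    refine LinearIndependent.of_comp linMap ?_
    have : ⇑linMap ∘ w = L := _root_.funext fun a ↦ hwL a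
    rw [this]; exact hli
  obtain ⟨b, hb⟩ := exists_basis_extending_first w hw (m := N + 1 - t) (by omega)
  obtain ⟨τ', hτ, hτ', hinv, hinv', hτli⟩ := exists_linearSubst_of_basis b
  refine ⟨fun j ↦ lin (b j), τ', hτ, hτ', hinv, hinv', fun a ↦ ?_, hτli⟩
  change lin (b ⟨a, _⟩) = L a
  rw [hb a, hwL a]

end First

/-! ### From line representations to `ChowOneGeneratedByLines` -/

section Convert

variable {k : Type u} [Field k]

attribute [local instance] MvPolynomial.gradedAlgebra ProjBaseChange.algebraBase

/-- **Line representations of all prime `1`-cycles give `ChowOneGeneratedByLines`.** [folklore] -/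
theorem chowOneGeneratedByLines_of_linesRep {N : ℕ} {X : SchemeOver k} [CompactSpace ↥X.left]
    (i : X ⟶ projectiveSpace N k)
    (h : ∀ z : ↥X.left, height z = 1 →
      LinesRep k (i.left : X.left ⟶ Proj (MvPolynomial.homogeneousSubmodule (Fin (N + 1)) k)) (primeCycle z)) :
    ChowOneGeneratedByLines N i := by
  classical
  refine (chowOneGeneratedByLines_iff_forall_primeCycle (N := N) (i := i)).mpr fun z hz ↦ ?_
  obtain ⟨r, ys, ws, hys, hrat⟩ := h z (by simpa using hz)
  refine ⟨Finset.univ.image ys, fun y ↦ ∑ a ∈ Finset.univ.filter (fun a ↦ ys a = y), ws a,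
    fun y hy ↦ ?_, ?_⟩
  · obtain ⟨a, -, rfl⟩ := Finset.mem_image.mp hy
    exact hys a
  · have hsum : ∑ y ∈ Finset.univ.image ys, (∑ a ∈ Finset.univ.filter (fun a ↦ ys a = y), ws a) •
        primeCycle y = ∑ a, ws a • primeCycle (ys a) := by
      rw [← Finset.sum_fiberwise_of_maps_to (g := ys) (s := Finset.univ) (t := Finset.univ.image ys)
        (fun a _ ↦ Finset.mem_image_of_mem ys (Finset.mem_univ a))]
      refine Finset.sum_congr rfl fun y _ ↦ ?_
      rw [Finset.sum_smul]
      refine Finset.sum_congr rfl fun a ha ↦ ?_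
      rw [(Finset.mem_filter.mp ha).2]
    rw [hsum]
    exact hrat

end Convert

/-! ### The rank-two case cannot occur -/

section RankTwo

variable {k : Type u} [Field k] {N : ℕ}

attribute [local instance] MvPolynomial.gradedAlgebra ProjBaseChange.algebraBase

local notation "𝓐" => MvPolynomial.homogeneousSubmodule (Fin (N + 1)) k

/-- **Two distinct coordinate subspaces of the same kind are incomparable**: if `V₊(xⱼ : j ∈ B) ⊆ V₊(xⱼ : j ∈ A)`
for Finsets `A, B ≠ univ` then `A ⊆ B`. [folklore] -/
theorem subset_of_zeroLocus_subset {A B : Finset (Fin (N + 1))} (hB : B ≠ Finset.univ)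
    (h : ProjectiveSpectrum.zeroLocus 𝓐 ((fun j ↦ (MvPolynomial.X j : MvPolynomial (Fin (N + 1)) k)) '' (B : Set _)) ⊆
      ProjectiveSpectrum.zeroLocus 𝓐 ((fun j ↦ (MvPolynomial.X j : MvPolynomial (Fin (N + 1)) k)) '' (A : Set _))) :
    A ⊆ B := by
  intro j hj
  -- the generic point of `V₊(x_B)` lies in `V₊(x_B) ⊆ V₊(x_A)`, so `x_j ∈ (x_b : b ∈ B)`
  have hPB : coordSubspacePoint (k := k) B hB ∈ ProjectiveSpectrum.zeroLocus 𝓐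
      ((fun j ↦ (MvPolynomial.X j : MvPolynomial (Fin (N + 1)) k)) '' (B : Set _)) := by
    have hc := closure_coordSubspacePoint (k := k) B hB
    exact ((Set.ext_iff.mp hc) _).mp (subset_closure rfl)
  have hPA := h hPB
  change _ ⊆ ((ProjectiveSpectrum.asHomogeneousIdeal (𝒜 := 𝓐) (coordSubspacePoint (k := k) B hB)).toIdeal :
    Set (MvPolynomial (Fin (N + 1)) k)) at hPA
  have hXj : (MvPolynomial.X j : MvPolynomial (Fin (N + 1)) k) ∈
      (ProjectiveSpectrum.asHomogeneousIdeal (𝒜 := 𝓐) (coordSubspacePoint (k := k) B hB)).toIdeal :=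
    hPA ⟨j, hj, rfl⟩
  rw [toIdeal_coordSubspacePoint] at hXj
  exact Finset.mem_coe.mp (Literature.RingTheory.MvPolynomial.X_mem_span_X_image_iff.mp hXj)

/-- **An irreducible set is not the union of two incomparable coordinate subspaces.** [folklore] -/
theorem false_of_isIrreducible_eq_union {A B : Finset (Fin (N + 1))} (hA : A ≠ Finset.univ) (hB : B ≠ Finset.univ)
    (hAB : ¬ A ⊆ B) (hBA : ¬ B ⊆ A) {Z : Set ↥(Proj 𝓐)} (hZ : IsIrreducible Z)
    (hZeq : Z = ProjectiveSpectrum.zeroLocus 𝓐 ((fun j ↦ (MvPolynomial.X j : MvPolynomial (Fin (N + 1)) k)) '' (A : Set _)) ∪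
      ProjectiveSpectrum.zeroLocus 𝓐 ((fun j ↦ (MvPolynomial.X j : MvPolynomial (Fin (N + 1)) k)) '' (B : Set _))) :
    False := by
  set ZA : Set ↥(Proj 𝓐) := ProjectiveSpectrum.zeroLocus 𝓐
    ((fun j ↦ (MvPolynomial.X j : MvPolynomial (Fin (N + 1)) k)) '' (A : Set _)) with hZA
  set ZB : Set ↥(Proj 𝓐) := ProjectiveSpectrum.zeroLocus 𝓐
    ((fun j ↦ (MvPolynomial.X j : MvPolynomial (Fin (N + 1)) k)) '' (B : Set _)) with hZB
  have hcA : IsClosed ZA := ProjectiveSpectrum.isClosed_zeroLocus _ _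
  have hcB : IsClosed ZB := ProjectiveSpectrum.isClosed_zeroLocus _ _
  rcases (isPreirreducible_iff_isClosed_union_isClosed.mp hZ.isPreirreducible) ZA ZB hcA hcB hZeq.le with h | h
  · -- `Z ⊆ ZA`, hence `ZB ⊆ ZA`, hence `A ⊆ B`
    exact hAB (subset_of_zeroLocus_subset (k := k) hB ((hZeq ▸ Set.subset_union_right).trans h))
  · exact hBA (subset_of_zeroLocus_subset (k := k) hA ((hZeq ▸ Set.subset_union_left).trans h))

end RankTwo

/-! ### Assembly: `CH₁` of a quadric inside a linear subspace -/

section Assembly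

variable {k : Type u} [Field k] {N : ℕ}

attribute [local instance] MvPolynomial.gradedAlgebra ProjBaseChange.algebraBase

local notation "𝓐" => MvPolynomial.homogeneousSubmodule (Fin (N + 1)) k

/-- The first `t` coordinate forms. [folklore] -/
def firstForms (t : ℕ) (ht : t ≤ N + 1) : Fin t → MvPolynomial (Fin (N + 1)) k :=
  fun a ↦ MvPolynomial.X ⟨a, by omega⟩

/-- Auxiliary computation (`linearIndependent_firstForms`). [folklore] -/
theorem linearIndependent_firstForms (t : ℕ) (ht : t ≤ N + 1) : LinearIndependent k (firstForms (k := k) t ht) :=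
  (MvPolynomial.linearIndependent_X (Fin (N + 1)) k).comp (fun a : Fin t ↦ (⟨a, by omega⟩ : Fin (N + 1)))
    fun a b hab ↦ Fin.ext (by simpa using congrArg Fin.val hab)

/-- Auxiliary computation (`isHomogeneous_firstForms`). [folklore] -/
theorem isHomogeneous_firstForms (t : ℕ) (ht : t ≤ N + 1) (a : Fin t) : (firstForms (k := k) t ht a).IsHomogeneous 1 :=
  MvPolynomial.isHomogeneous_X k _

/-- `{x_j : j < t}` is the range of the first coordinate forms. [folklore] -/
theorem image_X_lt_eq_range_firstForms (t : ℕ) (ht : t ≤ N + 1) :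
    (fun j ↦ (MvPolynomial.X j : MvPolynomial (Fin (N + 1)) k)) '' {j : Fin (N + 1) | (j : ℕ) < t} =
      Set.range (firstForms (k := k) t ht) := by
  ext f
  simp only [Set.mem_image, Set.mem_setOf_eq, Set.mem_range, firstForms]
  constructor
  · rintro ⟨j, hj, rfl⟩; exact ⟨⟨j, hj⟩, rfl⟩
  · rintro ⟨a, rfl⟩; exact ⟨⟨a, by omega⟩, a.isLt, rfl⟩

/-- Membership in the zero locus of `{x_j : j < t} ∪ {G}`. [folklore] -/
theorem mem_zeroLocus_X_lt_union_iff (t : ℕ) (G : MvPolynomial (Fin (N + 1)) k) (z : ↥(Proj 𝓐)) :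
    z ∈ ProjectiveSpectrum.zeroLocus 𝓐
        ((fun j ↦ (MvPolynomial.X j : MvPolynomial (Fin (N + 1)) k)) '' {j : Fin (N + 1) | (j : ℕ) < t} ∪ {G}) ↔
      (∀ j : Fin (N + 1), (j : ℕ) < t →
          (MvPolynomial.X j : MvPolynomial (Fin (N + 1)) k) ∈ (z : ProjectiveSpectrum 𝓐).asHomogeneousIdeal) ∧
        G ∈ (z : ProjectiveSpectrum 𝓐).asHomogeneousIdeal := by
  change _ ∪ _ ⊆ ((z : ProjectiveSpectrum 𝓐).asHomogeneousIdeal : Set (MvPolynomial (Fin (N + 1)) k)) ↔ _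
  rw [Set.union_subset_iff, Set.singleton_subset_iff, Set.image_subset_iff]
  exact ⟨fun ⟨h1, h2⟩ ↦ ⟨fun j hj ↦ h1 hj, h2⟩, fun ⟨h1, h2⟩ ↦ ⟨fun j hj ↦ h1 j hj, h2⟩⟩

/-- Membership in the zero locus of the first `t` coordinate forms. [folklore] -/
theorem mem_zeroLocus_range_firstForms_iff (t : ℕ) (ht : t ≤ N + 1) (z : ↥(Proj 𝓐)) :
    z ∈ ProjectiveSpectrum.zeroLocus 𝓐 (Set.range (firstForms (k := k) t ht)) ↔
      ∀ j : Fin (N + 1), (j : ℕ) < t →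
        (MvPolynomial.X j : MvPolynomial (Fin (N + 1)) k) ∈ (z : ProjectiveSpectrum 𝓐).asHomogeneousIdeal := by
  rw [← image_X_lt_eq_range_firstForms]
  change _ ⊆ ((z : ProjectiveSpectrum 𝓐).asHomogeneousIdeal : Set (MvPolynomial (Fin (N + 1)) k)) ↔ _
  rw [Set.image_subset_iff]
  exact ⟨fun h j hj ↦ h hj, fun h j hj ↦ h j hj⟩

variable [IsAlgClosed k]

/-- **`CH₁` of an integral quadric inside a linear subspace.** Let `e : Y ↪ ℙᴺ_k` be a closed
immersion from an integral compact scheme with image `V₊(Q, L₁, …, L_t)` for a quadratic form `Q`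
and `t` independent linear forms with `N - t ≥ 3`, over an algebraically closed field with `2 ≠ 0`.
Then every `1`-cycle on `Y` has a line representation. [cite: Fulton1998, Example 1.9.1]
[cite: Hartshorne1977, II Example 7.1.1] -/
theorem linesRep_of_range_eq_zeroLocus_quadric_linear (h2 : (2 : k) ≠ 0) {t : ℕ} (htN : t + 3 ≤ N)
    (L : Fin t → MvPolynomial (Fin (N + 1)) k) (hli : LinearIndependent k L) (hL : ∀ a, (L a).IsHomogeneous 1)
    (Q : MvPolynomial (Fin (N + 1)) k) (hQ : Q.IsHomogeneous 2)
    {Y : Scheme.{u}} [IsIntegral Y] [CompactSpace ↥Y] (e : Y ⟶ Proj 𝓐) [IsClosedImmersion e]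
    (hrange : Set.range e.base = ProjectiveSpectrum.zeroLocus 𝓐 ({Q} ∪ Set.range L))
    (c : AlgebraicCycle Y ℤ) (hc : c ∈ cyclesOfDim Y 1) : LinesRep k e c := by
  classical
  -- the set `{x_j : j < t}`
  let Xs : Set (MvPolynomial (Fin (N + 1)) k) :=
    (fun j ↦ (MvPolynomial.X j : MvPolynomial (Fin (N + 1)) k)) '' {j : Fin (N + 1) | (j : ℕ) < t}
  -- (1) move the linear forms to the first coordinates
  obtain ⟨τ₁, τ₁', hτ₁, hτ₁', hinv₁, hinv₁', hτL, -⟩ := exists_linearSubst_first (by omega) L hL hli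
  let σ₁ := ProjectiveSpace.substMapHom τ₁ hτ₁ τ₁' hτ₁' hinv₁
  haveI : IsIso σ₁ := isIso_substMapHom τ₁ hτ₁ τ₁' hτ₁' hinv₁ hinv₁'
  let Q₁ := MvPolynomial.aeval τ₁' Q
  have hQ₁ : Q₁.IsHomogeneous 2 := hQ.aeval τ₁' hτ₁'
  have himgXs : MvPolynomial.aeval τ₁ '' Xs = Set.range L := by
    ext f
    simp only [Xs, Set.image_image, Set.mem_image, Set.mem_setOf_eq, Set.mem_range, MvPolynomial.aeval_X]
    constructor
    · rintro ⟨j, hj, rfl⟩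
      refine ⟨⟨j, hj⟩, ?_⟩
      rw [← hτL ⟨j, hj⟩]
    · rintro ⟨a, rfl⟩
      exact ⟨⟨a, by omega⟩, a.isLt, hτL a⟩
  have hrange₁ : Set.range (e ≫ σ₁).base = ProjectiveSpectrum.zeroLocus 𝓐 (Xs ∪ {Q₁}) := by
    have hpre : σ₁.base ⁻¹' ProjectiveSpectrum.zeroLocus 𝓐 (Xs ∪ {Q₁}) = Set.range e.base := by
      rw [substMapHom_preimage_zeroLocus, Set.image_union, Set.image_singleton, himgXs, hrange, Set.union_comm]
      change ProjectiveSpectrum.zeroLocus 𝓐 ({MvPolynomial.aeval τ₁ (MvPolynomial.aeval τ₁' Q)} ∪ _) = _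
      rw [hinv₁]
    rw [Scheme.Hom.comp_base, TopCat.coe_comp, Set.range_comp, ← hpre]
    exact Set.image_preimage_eq _ σ₁.homeomorph.surjective
  -- (2) kill the first coordinates in the quadric
  let S : Set (Fin (N + 1)) := {j | (j : ℕ) < t}
  let Q₂ := killSet k S Q₁
  have hfam : ∀ j : Fin (N + 1),
      (if j ∈ S then (0 : MvPolynomial (Fin (N + 1)) k) else MvPolynomial.X j).IsHomogeneous 1 := fun j ↦ by
    by_cases hj : j ∈ S
    · rw [if_pos hj]; exact MvPolynomial.isHomogeneous_zero _ _ _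
    · rw [if_neg hj]; exact MvPolynomial.isHomogeneous_X k j
  have hQ₂ : Q₂.IsHomogeneous 2 := by
    have h := hQ₁.aeval _ hfam
    exact h
  have hzl : ∀ (G : MvPolynomial (Fin (N + 1)) k) (z : ↥(Proj 𝓐)), z ∈ ProjectiveSpectrum.zeroLocus 𝓐 (Xs ∪ {G}) ↔
      (∀ j : Fin (N + 1), (j : ℕ) < t →
        (MvPolynomial.X j : MvPolynomial (Fin (N + 1)) k) ∈ (z : ProjectiveSpectrum 𝓐).asHomogeneousIdeal) ∧
        G ∈ (z : ProjectiveSpectrum 𝓐).asHomogeneousIdeal := fun G z ↦ mem_zeroLocus_X_lt_union_iff t G z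
  have hkill : killSet k S Q₂ = Q₂ := killSet_killSet S Q₁
  have hZ : ProjectiveSpectrum.zeroLocus 𝓐 (Xs ∪ {Q₁}) = (ProjectiveSpectrum.zeroLocus 𝓐 (Xs ∪ {Q₂}) :
      Set ↥(Proj 𝓐)) := by
    refine Set.ext fun z ↦ (hzl Q₁ z).trans (Iff.trans ?_ (hzl Q₂ z).symm)
    refine and_congr_right fun hX ↦ ?_
    have hspan : Ideal.span Xs ≤ (z : ProjectiveSpectrum 𝓐).asHomogeneousIdeal.toIdeal := by
      rw [Ideal.span_le]
      rintro f ⟨j, hj, rfl⟩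
      exact hX j hj
    have hdiff : Q₁ - Q₂ ∈ (z : ProjectiveSpectrum 𝓐).asHomogeneousIdeal.toIdeal := hspan (sub_killSet_mem S Q₁)
    constructor
    · intro h
      have := Ideal.sub_mem _ h hdiff
      rwa [sub_sub_cancel] at this
    · intro h
      have := Ideal.add_mem _ hdiff h
      rwa [sub_add_cancel] at this
  -- (3) normal form of the remaining quadratic form in the last `N - t + 1` variables
  obtain ⟨N', hN'⟩ : ∃ N', t + N' = N := ⟨N - t, by omega⟩
  let q := extractBlock k t N' hN' Q₂
  have hq : q.IsHomogeneous 2 := isHomogeneous_extractBlock k t N' hN' hQ₂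
  obtain ⟨r, hr, τs, τs', hτs, hτs', hinvs, hinvs', -, hqs⟩ := exists_linearSubst_splitFormAt_rank (N := N') h2 hq
  let τ₂ := extendSubst k t N' hN' τs
  let τ₂' := extendSubst k t N' hN' τs'
  have hτ₂ := isHomogeneous_extendSubst k t N' hN' τs hτs
  have hτ₂' := isHomogeneous_extendSubst k t N' hN' τs' hτs'
  have hinv₂ := extendSubst_inv k t N' hN' τs τs' hinvs
  have hinv₂' := extendSubst_inv k t N' hN' τs' τs hinvs'
  let σ₂ := ProjectiveSpace.substMapHom τ₂ hτ₂ τ₂' hτ₂' hinv₂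
  haveI : IsIso σ₂ := isIso_substMapHom τ₂ hτ₂ τ₂' hτ₂' hinv₂ hinv₂'
  have hsf : splitFormAt k t r (by omega) = MvPolynomial.rename (embIdx t N' hN') (splitFormAt k 0 r (by omega)) := by
    simpa using (rename_embIdx_splitFormAt k t N' hN' r 0 (by omega)).symm
  have hkey : MvPolynomial.aeval τ₂ (splitFormAt k t r (by omega)) = Q₂ := by
    rw [hsf]
    have h1 := congr($(aeval_extendSubst_comp_rename k t N' hN' τs) (splitFormAt k 0 r (by omega)))
    simp only [AlgHom.coe_comp, Function.comp_apply] at h1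
    change MvPolynomial.aeval (extendSubst k t N' hN' τs) _ = _
    rw [h1, hqs, rename_embIdx_extractBlock k t N' hN' hkill]
  have himgXs₂ : MvPolynomial.aeval τ₂ '' Xs = Xs := by
    ext f
    simp only [Xs, Set.image_image, Set.mem_image, Set.mem_setOf_eq, MvPolynomial.aeval_X]
    constructor
    · rintro ⟨j, hj, rfl⟩; exact ⟨j, hj, (extendSubst_of_lt k t N' hN' τs hj).symm⟩
    · rintro ⟨j, hj, rfl⟩; exact ⟨j, hj, extendSubst_of_lt k t N' hN' τs hj⟩
  have hrange₂ : Set.range ((e ≫ σ₁) ≫ σ₂).base = stratum (k := k) t r (by omega) := by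
    have hpre : σ₂.base ⁻¹' stratum (k := k) t r (by omega) = Set.range (e ≫ σ₁).base := by
      rw [stratum, coneGens, substMapHom_preimage_zeroLocus, Set.image_union, Set.image_singleton, hkey,
        himgXs₂, hrange₁, hZ]
    rw [Scheme.Hom.comp_base ((e ≫ σ₁)), TopCat.coe_comp, Set.range_comp, ← hpre]
    exact Set.image_preimage_eq _ σ₂.homeomorph.surjective
  -- (4) the rank cases
  have main : LinesRep k ((e ≫ σ₁) ≫ σ₂) c := by
    rcases (show r = 0 ∨ r = 1 ∨ r = 2 ∨ 3 ≤ r by omega) with hr0 | hr1 | hr2 | hr3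
    · -- `r = 0`: the image is the linear subspace `x_{<t} = 0`
      subst hr0
      refine linesRep_of_range_eq_zeroLocus_linear (by omega) (firstForms (k := k) t (by omega))
        (linearIndependent_firstForms t _) (isHomogeneous_firstForms t _) _ ?_ c hc
      rw [hrange₂, stratum, coneGens, splitFormAt_zero]
      refine Set.ext fun z ↦ (hzl 0 z).trans (Iff.trans ?_ (mem_zeroLocus_range_firstForms_iff t _ z).symm)
      exact ⟨fun h ↦ h.1, fun h ↦ ⟨h, Ideal.zero_mem _⟩⟩
    · -- `r = 1`: the image is the linear subspace `x_{≤t} = 0` (`x_t² = 0`)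
      subst hr1
      refine linesRep_of_range_eq_zeroLocus_linear (by omega) (firstForms (k := k) (t + 1) (by omega))
        (linearIndependent_firstForms (t + 1) _) (isHomogeneous_firstForms (t + 1) _) _ ?_ c hc
      rw [hrange₂, stratum, coneGens, splitFormAt_one]
      refine Set.ext fun z ↦ (hzl _ z).trans (Iff.trans ?_ (mem_zeroLocus_range_firstForms_iff (t + 1) _ z).symm)
      constructor
      · rintro ⟨hX, hq1⟩ j hj
        by_cases hjt : (j : ℕ) < t
        · exact hX j hjt
        · have hj' : j = ⟨t, by omega⟩ := Fin.ext (by simp; omega)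
          rw [hj']
          exact ((z : ProjectiveSpectrum 𝓐).isPrime.mem_or_mem hq1).elim id id
      · intro hX
        exact ⟨fun j hj ↦ hX j (by omega), Ideal.mul_mem_right _ _ (hX ⟨t, by omega⟩ (by simp))⟩
    · -- `r = 2`: the image would be the union of two incomparable coordinate subspaces
      exfalso
      subst hr2
      let A : Finset (Fin (N + 1)) := Finset.univ.filter fun j ↦ (j : ℕ) < t ∨ (j : ℕ) = t
      let B : Finset (Fin (N + 1)) := Finset.univ.filter fun j ↦ (j : ℕ) < t ∨ (j : ℕ) = t + 1
      have hA : A ≠ Finset.univ := fun h ↦ by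
        have : (⟨t + 1, by omega⟩ : Fin (N + 1)) ∈ A := h ▸ Finset.mem_univ _
        simp [A] at this
      have hB : B ≠ Finset.univ := fun h ↦ by
        have : (⟨t, by omega⟩ : Fin (N + 1)) ∈ B := h ▸ Finset.mem_univ _
        simp [B] at this
      have hAB : ¬ A ⊆ B := fun h ↦ by
        have : (⟨t, by omega⟩ : Fin (N + 1)) ∈ B := h (by simp [A])
        simp [B] at this
      have hBA : ¬ B ⊆ A := fun h ↦ by
        have : (⟨t + 1, by omega⟩ : Fin (N + 1)) ∈ A := h (by simp [B])
        simp [A] at this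
      haveI : IrreducibleSpace ↥Y := inferInstance
      have hirr : IsIrreducible (Set.range ((e ≫ σ₁) ≫ σ₂).base) := by
        rw [← Set.image_univ]
        exact (IrreducibleSpace.isIrreducible_univ _).image _ (Scheme.Hom.continuous _).continuousOn
      refine false_of_isIrreducible_eq_union (k := k) hA hB hAB hBA hirr ?_
      rw [hrange₂, stratum, coneGens, splitFormAt_add_two, splitFormAt_zero, add_zero]
      refine Set.ext fun z ↦ (hzl _ z).trans (Iff.trans ?_ (Set.mem_union _ _ _).symm)
      have hmemA : z ∈ ProjectiveSpectrum.zeroLocus 𝓐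
          ((fun j ↦ (MvPolynomial.X j : MvPolynomial (Fin (N + 1)) k)) '' (A : Set _)) ↔
            ∀ j : Fin (N + 1), ((j : ℕ) < t ∨ (j : ℕ) = t) →
              (MvPolynomial.X j : MvPolynomial (Fin (N + 1)) k) ∈ (z : ProjectiveSpectrum 𝓐).asHomogeneousIdeal := by
        change _ ⊆ ((z : ProjectiveSpectrum 𝓐).asHomogeneousIdeal : Set (MvPolynomial (Fin (N + 1)) k)) ↔ _
        rw [Set.image_subset_iff]
        simp only [A, Finset.coe_filter, Finset.mem_univ, true_and, Set.setOf_subset, Set.mem_preimage,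
          SetLike.mem_coe]
      have hmemB : z ∈ ProjectiveSpectrum.zeroLocus 𝓐
          ((fun j ↦ (MvPolynomial.X j : MvPolynomial (Fin (N + 1)) k)) '' (B : Set _)) ↔
            ∀ j : Fin (N + 1), ((j : ℕ) < t ∨ (j : ℕ) = t + 1) →
              (MvPolynomial.X j : MvPolynomial (Fin (N + 1)) k) ∈ (z : ProjectiveSpectrum 𝓐).asHomogeneousIdeal := by
        change _ ⊆ ((z : ProjectiveSpectrum 𝓐).asHomogeneousIdeal : Set (MvPolynomial (Fin (N + 1)) k)) ↔ _
        rw [Set.image_subset_iff]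
        simp only [B, Finset.coe_filter, Finset.mem_univ, true_and, Set.setOf_subset, Set.mem_preimage,
          SetLike.mem_coe]
      rw [hmemA, hmemB]
      constructor
      · rintro ⟨hX, hq2⟩
        rcases (z : ProjectiveSpectrum 𝓐).isPrime.mem_or_mem hq2 with h | h
        · left
          rintro j (hj | hj)
          · exact hX j hj
          · have : j = ⟨t, by omega⟩ := Fin.ext hj
            rw [this]; exact h
        · right
          rintro j (hj | hj)
          · exact hX j hj
          · have : j = ⟨t + 1, by omega⟩ := Fin.ext hj
            rw [this]; exact h
      · rintro (h | h)
        · exact ⟨fun j hj ↦ h j (Or.inl hj), Ideal.mul_mem_right _ _ (h ⟨t, by omega⟩ (Or.inr rfl))⟩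
        · exact ⟨fun j hj ↦ h j (Or.inl hj), Ideal.mul_mem_left _ _ (h ⟨t + 1, by omega⟩ (Or.inr rfl))⟩
    · -- `r ≥ 3`: a genuine quadric stratum
      obtain ⟨m, rfl⟩ : ∃ m, r = m + 2 := ⟨r - 2, by omega⟩
      exact linesRep_of_range_eq_stratum m (by omega) t (by omega) (by omega) _ hrange₂ c hc
  exact LinesRep.of_comp_substMapHom e τ₁ hτ₁ τ₁' hτ₁' hinv₁ hinv₁'
    (LinesRep.of_comp_substMapHom (e ≫ σ₁) τ₂ hτ₂ τ₂' hτ₂' hinv₂ hinv₂' main)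

end Assembly

end ProjectiveSpaceCells

/-! ### Tian–Zong Thm. 1.7 for the multidegrees `(2, 1, …, 1)` -/

section Fact

attribute [local instance] MvPolynomial.gradedAlgebra ProjBaseChange.algebraBase

/-- `V₊(S) = V₊(S')` whenever the ideals spanned agree. [folklore] -/
theorem ProjectiveSpaceCells.zeroLocus_eq_of_span_eq {k : Type u} [Field k] {N : ℕ}
    {S S' : Set (MvPolynomial (Fin (N + 1)) k)} (h : Ideal.span S = Ideal.span S') :
    ProjectiveSpectrum.zeroLocus (MvPolynomial.homogeneousSubmodule (Fin (N + 1)) k) S =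
      ProjectiveSpectrum.zeroLocus (MvPolynomial.homogeneousSubmodule (Fin (N + 1)) k) S' := by
  rw [← ProjectiveSpectrum.zeroLocus_span _ S, ← ProjectiveSpectrum.zeroLocus_span _ S', h]

/-- Ideal spans of sets of linear forms with the same `k`-span agree. [folklore] -/
theorem ProjectiveSpaceCells.ideal_span_eq_of_span_eq {k : Type u} [Field k] {σ : Type*}
    {S S' : Set (MvPolynomial σ k)} (h : Submodule.span k S = Submodule.span k S') :
    Ideal.span S = Ideal.span S' := by
  apply le_antisymm
  · rw [Ideal.span_le]
    intro f hf
    have h1 : f ∈ Submodule.span k S' := h ▸ Submodule.subset_span hf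
    exact (Submodule.span_le.mpr (Ideal.subset_span (α := MvPolynomial σ k)) :
      Submodule.span k S' ≤ (Ideal.span S').restrictScalars k) h1
  · rw [Ideal.span_le]
    intro f hf
    have h1 : f ∈ Submodule.span k S := h.symm ▸ Submodule.subset_span hf
    exact (Submodule.span_le.mpr (Ideal.subset_span (α := MvPolynomial σ k)) :
      Submodule.span k S ≤ (Ideal.span S).restrictScalars k) h1

/-- **Tian–Zong Thm. 1.7 for complete intersections of a quadric with hyperplanes.** The named fact
`TianZong2014_chowOne_generatedByLines` in the case of multidegrees with exactly one `dₐ = 2` and all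
other `dₐ = 1`: `X` is then a (smooth) quadric in a linear subspace `≅ ℙⁿ⁺¹` of `ℙⁿ⁺ᶜ`, and `CH₁(X)`
is generated by lines (split normal form of any rank + cellular decomposition; the Jacobian
hypothesis is not even needed). [cite: TianZong2014, Thm. 1.7 (quadrics in linear subspaces)]
[cite: Fulton1998, Example 1.9.1] -/
theorem TianZong2014_chowOne_generatedByLines_quadricSection ⦃k : Type u⦄ [Field k] [IsAlgClosed k]
    [CharZero k] ⦃c : ℕ⦄ (n : ℕ) (d : Fin c → ℕ) ⦃X : SchemeOver k⦄
    (F : Fin c → MvPolynomial (Fin (n + c + 1)) k) (i : X ⟶ projectiveSpace (n + c) k)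
    (hX : IsSmoothProjective n X)
    (hF : letI := MvPolynomial.gradedAlgebra (σ := Fin (n + c + 1)) (R := k)
      ∀ a, (F a).IsHomogeneous (d a))
    (hi : IsClosedImmersion i.left)
    (hV : letI := MvPolynomial.gradedAlgebra (σ := Fin (n + c + 1)) (R := k)
      Set.range i.left.base =
        ProjectiveSpectrum.zeroLocus (MvPolynomial.homogeneousSubmodule (Fin (n + c + 1)) k)
          (Set.range F))
    (hdeg : (∑ a, d a) + 1 ≤ n + c) (hq : ∃ a₀, d a₀ = 2 ∧ ∀ a, a ≠ a₀ → d a = 1) :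
    ChowOneGeneratedByLines (n + c) i := by
  classical
  obtain ⟨a₀, ha₀, hothers⟩ := hq
  obtain ⟨c', rfl⟩ : ∃ c', c = c' + 1 := ⟨c - 1, by have := a₀.isLt; omega⟩
  -- degree count: `Σ d = 2 + c'`, so `n ≥ 2`
  have hsum : ∑ a, d a = 2 + c' := by
    rw [Fin.sum_univ_succAbove d a₀, ha₀]
    congr 1
    rw [Finset.sum_congr rfl fun b _ ↦ hothers _ (Fin.succAbove_ne a₀ b)]
    simp
  have hn : 2 ≤ n := by omega
  haveI : CompactSpace ↥X.left := IsSmoothProjective.compactSpace_holds hX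
  haveI : IsIntegral X.left := IsSmoothProjective.isIntegral_holds hX
  -- the quadric and an independent subfamily of the linear forms
  have hQ : (F a₀).IsHomogeneous 2 := by have h := hF a₀; rwa [ha₀] at h
  let v : Fin c' → MvPolynomial (Fin (n + (c' + 1) + 1)) k := fun b ↦ F (a₀.succAbove b)
  have hv : ∀ b, (v b).IsHomogeneous 1 := fun b ↦ by
    have h := hF (a₀.succAbove b); rwa [hothers _ (Fin.succAbove_ne a₀ b)] at h
  obtain ⟨κ, a, hainj, hspan, hli⟩ := exists_linearIndependent' (K := k) v
  haveI : Fintype κ := Fintype.ofInjective a hainj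
  let t := Fintype.card κ
  have htc : t ≤ c' := by simpa using Fintype.card_le_of_injective a hainj
  let eκ : κ ≃ Fin t := Fintype.equivFin κ
  let L : Fin t → MvPolynomial (Fin (n + (c' + 1) + 1)) k := fun j ↦ v (a (eκ.symm j))
  have hL : ∀ j, (L j).IsHomogeneous 1 := fun j ↦ hv _
  have hLi : LinearIndependent k L := hli.comp _ eκ.symm.injective
  have hrangeL : Set.range L = Set.range (v ∘ a) := by
    ext f
    simp only [Set.mem_range, L, Function.comp_apply]
    exact ⟨fun ⟨j, hj⟩ ↦ ⟨_, hj⟩, fun ⟨x, hx⟩ ↦ ⟨eκ x, by simpa using hx⟩⟩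
  -- `V₊(F) = V₊(F a₀, L)`
  have hrangeF : Set.range F = {F a₀} ∪ Set.range v := by
    ext f
    simp only [Set.mem_range, Set.singleton_union, Set.mem_insert_iff, v]
    constructor
    · rintro ⟨b, rfl⟩
      rcases Fin.eq_self_or_eq_succAbove a₀ b with rfl | ⟨b', rfl⟩
      · exact Or.inl rfl
      · exact Or.inr ⟨b', rfl⟩
    · rintro (rfl | ⟨b, rfl⟩)
      · exact ⟨a₀, rfl⟩
      · exact ⟨_, rfl⟩
  have hV' : Set.range i.left.base =
      ProjectiveSpectrum.zeroLocus (MvPolynomial.homogeneousSubmodule (Fin (n + (c' + 1) + 1)) k)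
        ({F a₀} ∪ Set.range L) := by
    rw [hV, hrangeF]
    refine ProjectiveSpaceCells.zeroLocus_eq_of_span_eq ?_
    rw [Ideal.span_union, Ideal.span_union, hrangeL]
    congr 1
    exact ProjectiveSpaceCells.ideal_span_eq_of_span_eq hspan.symm
  -- the quadric-in-a-linear-subspace argument
  refine ProjectiveSpaceCells.chowOneGeneratedByLines_of_linesRep i fun z hz ↦ ?_
  let i' : X.left ⟶ Proj (MvPolynomial.homogeneousSubmodule (Fin (n + (c' + 1) + 1)) k) := i.left
  haveI : IsClosedImmersion i' := hi
  exact ProjectiveSpaceCells.linesRep_of_range_eq_zeroLocus_quadric_linear (N := n + (c' + 1))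
    two_ne_zero (by omega) L hLi hL (F a₀) hQ i' hV' (primeCycle z)
    (primeCycle_mem_cyclesOfDim (by simpa using hz))

/-- **What remains of Tian–Zong Thm. 1.7.** The named fact `TianZong2014_chowOne_generatedByLines`
follows from its restriction to multidegrees with `Σₐ (dₐ - 1) ≥ 2` (at least two quadrics, or a
form of degree `≥ 3`): the complementary cases `Σₐ (dₐ - 1) ≤ 1` are the all-linear case
(`TianZong2014_chowOne_generatedByLines_of_forall_eq_one`, `Motives/LinesGenerateChowOneLinear`) and
the one-quadric case (`TianZong2014_chowOne_generatedByLines_quadricSection`), both proved.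
[cite: TianZong2014, Thm. 1.7] -/
theorem TianZong2014_chowOne_generatedByLines_of_two_le_sum
    (h : ∀ ⦃k : Type u⦄ [Field k] [IsAlgClosed k] [CharZero k] ⦃c : ℕ⦄ (n : ℕ) (d : Fin c → ℕ)
      ⦃X : SchemeOver k⦄ (F : Fin c → MvPolynomial (Fin (n + c + 1)) k)
      (i : X ⟶ projectiveSpace (n + c) k),
      letI := MvPolynomial.gradedAlgebra (σ := Fin (n + c + 1)) (R := k)
      IsSmoothProjective n X → (∀ a, (F a).IsHomogeneous (d a)) → (∀ a, 0 < d a) →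
        IsNonsingularSystem k F → IsClosedImmersion i.left →
          Set.range i.left.base =
            ProjectiveSpectrum.zeroLocus (MvPolynomial.homogeneousSubmodule (Fin (n + c + 1)) k)
              (Set.range F) →
            (∑ a, d a) + 1 ≤ n + c → 2 ≤ ∑ a, (d a - 1) → ChowOneGeneratedByLines (n + c) i) :
    TianZong2014_chowOne_generatedByLines.{u} := by
  intro k _ _ _ c n d X F i hX hF hd hJ hi hV hdeg
  by_cases hres : 2 ≤ ∑ a, (d a - 1)
  · exact h n d F i hX hF hd hJ hi hV hdeg hres
  · push Not at hres
    by_cases hall : ∀ a, d a = 1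
    · exact TianZong2014_chowOne_generatedByLines_of_forall_eq_one n d F i hX hF hJ hi hV hdeg hall
    · push Not at hall
      obtain ⟨a₀, ha₀⟩ := hall
      have hpos : 1 ≤ d a₀ - 1 := by have := hd a₀; omega
      have hsplit : ∑ a, (d a - 1) = (d a₀ - 1) + ∑ a ∈ Finset.univ.erase a₀, (d a - 1) :=
        (Finset.add_sum_erase _ _ (Finset.mem_univ a₀)).symm
      have hrest : ∑ a ∈ Finset.univ.erase a₀, (d a - 1) = 0 := by omega
      have hq : ∃ a₀, d a₀ = 2 ∧ ∀ a, a ≠ a₀ → d a = 1 := by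
        refine ⟨a₀, by omega, fun a ha ↦ ?_⟩
        have h0 : d a - 1 = 0 := by
          have hle : d a - 1 ≤ ∑ a ∈ Finset.univ.erase a₀, (d a - 1) :=
            Finset.single_le_sum (f := fun a ↦ d a - 1) (fun _ _ ↦ Nat.zero_le _)
              (Finset.mem_erase.mpr ⟨ha, Finset.mem_univ a⟩)
          omega
        have := hd a
        omega
      exact TianZong2014_chowOne_generatedByLines_quadricSection n d F i hX hF hi hV hdeg hq

end Fact

end Literature.AlgebraicGeometry.Motives
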